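import Literature.MathematicalPhysics.QuantumFieldTheory.Balaban1983to89.B6Prop23MultiLevelTorus
import Literature.MathematicalPhysics.QuantumFieldTheory.Balaban1983to89.B6Prop22KLevelTorusCensusEta
import Literature.MathematicalPhysics.QuantumFieldTheory.Balaban1983to89.B6Ineq288Edge

/-!
# `Balaban1983to89.B6Prop23KLevelTorusCensus` — [B6] PROPOSITION 2.3 (2.87) IN THE CENSUS TYPING `B6.Prop23Printed`
ON THE GENUINE `k`-LEVEL TORUS FAMILY IN PRINT'S UNITS: the named fact of the census module `…B6` INHABITED by the family
of all nested families of domains of the torus `KTIdx d ℓ` (file T8 `B6Prop22KLevelTorusCensus`, print's carrier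
`Ω₁ = T_η`, `η = L^{−k}`, geometry `B6Prop22KLevelTorusCensusEta.geoTP`) with the carrier kernel `Cinv i` = THE
(2.69)-kernel of `(Q′G′²Q′*)⁻¹` of the member (file 4 of the torus `(Q′G′²Q′*)⁻¹` programme of seat p21; no existing
module is touched; no fact is minted)

FRAMING (verbatim cell line):
statement-level skeleton of published theorems with citation tags; proofs where landed; nothing here is a claim about the Yang–Mills mass gap

Source under audit (cell pub-balaban / lit-balaban): T. Bałaban, *Propagators and renormalization transformations for
lattice gauge theories. II*, Commun. Math. Phys. **96** (1984) 223–250 [`Balaban1984PropagatorsII`, "B6"], p. 238 [PDF 16]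
(Proposition 2.3, (2.86)–(2.87)), p. 235 [PDF 13] ((2.69)–(2.70)), p. 224 [PDF 2] ((2.1): «we admit the case when some
domains Ω_j are equal to T_η») — held text `paper:balaban1984-cmp96-propagators-rt-ii` p0002, p0013, p0016 re-read this
generation.  Unit `lit-balaban-p21` (Phase-2 proof seat p21 gen 16), HOME `run/shared/lean/pub/lit-balaban/`, free-target
protocol G.5-34(d) (B6-CLOSURE item 7 (d2) of the fold owner r03), referee ref-4.

## WHAT IS PRINTED (p. 238, verbatim up to notation)

«**Proposition 2.3.** An inverse of the operator Q′G′²Q′* is given by the convergent expansion (Q′G′²Q′*)⁻¹ =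
C(I − R)⁻¹ = Σ_{n=0}^∞ CRⁿ = …, (2.86) and it satisfies the estimate |(Q′G′²Q′*)⁻¹(y, y′)| ≤
O(1)(L^jη)^{−4}(L^{j′}η)^{−d}e^{−½δ₁d(y,y′)}, y, y′ ∈ 𝔅, y ∈ Λ_j, y′ ∈ Λ_{j′}. (2.87)»  — typed verbatim by the census
module as `B6.Prop23Printed d geo Cinv` («∃ M₁ δ₁ C > 0, ∀ i, (2.1)–(2.2) → M₁ ≤ M → ∀ y y′, |Cinv(y, y′)| ≤
C(L^jη)^{−4}(L^{j′}η)^{−d}e^{−½δ₁d(y,y′)}»).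

## WHAT THIS FILE CERTIFIES (kernel-checked)

* §1 for EVERY member `i : KTIdx d ℓ` (a nested family `D` of domains of the torus with `k ≥ 1` levels, `Ω₁ = T_η`,
  `M_h ≥ 1`, `R ≥ 2L`, `P_μ ≥ 4`, the printed weights `a_j = aPrinted 1`, `L ≥ 2`): the operator `K_W(X) = Q′G′²Q′*` on
  `ℝ^𝔅` (`XopT`, `X` = the (2.69)-kernel `B8Ineq192MultiLevelTorus.XkT`, `G′ = gmlT` genuine) is INVERTIBLE with NO
  threshold on `M` (the conjugated kernel is coercive on all of `𝔅`, file 3's `isUnit_BmT`; `isUnit_BmT_member`,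
  `XopT_isUnit`), its inverse IS file 3's `GinvT` (`GinvT_mul_XopT`, `XopT_mul_GinvT`, uniqueness `GinvT_unique_member`);
  the carrier kernel IN PRINT'S UNITS `Cinv i (y, y′) = η^{−4−(d+1)}·GinvT(y, y′)/(L^{j′})^{d+1}` (`CinvTP`: `G′ ↦ η²G′`,
  the pairing weight `(L^jη)^{d+1} = η^{d+1}W`);
* §2 **`prop23Printed_kLevelTorusP : B6.Prop23Printed (d + 1) (fun i : KTIdx d ℓ => geoTP i) (fun i => CinvTP i)`** —
  the printed Proposition 2.3 (2.87) in the census typing, for the lattice dimension `d + 1`, on the genuine `k`-level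
  TORUS family in print's units, with witnesses `(M₁, δ₁, C)` from `B6Prop23MultiLevelTorus.prop23_multiLevelTorus` and
  the rescaling `(L^jη)^{−4}(L^{j′}η)^{−(d+1)} = η^{−4−(d+1)}(L^j)^{−4}(L^{j′})^{−(d+1)}`;
  `prop23Printed_kLevelTorusP_nonvacuous` — members above any threshold with `k` genuine levels exist (file T9's
  `kLevelTorusP_nonvacuous`), and `prop23Printed_kLevelTorusP_top` — print's admitted member `Ω₁ = … = Ω_k = T_η` is
  among them, so the inhabited fact is not vacuous;
* §3 `ineq288_edge_kLevelTorusP` — the census DAG edge «Prop. 2.2 ∧ Prop. 2.3 ⟹ (2.88)»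
  (`B6Ineq288Edge.ineq288_of_printed`) FIRED on the genuine `k`-level torus family: both typed antecedents are theorems
  on ONE family (file T9's `prop22Printed_kLevelTorusP` and `prop23Printed_kLevelTorusP`), so the edge's conclusion —
  (2.88) for every member, under the edge's located reading of the outer kernels and its per-member Lemma-2.1 / threshold
  hypotheses (unchanged, NOT discharged here; discharged in the sequel `B6Ineq288MultiLevelTorus`) — holds on `geoTP`
  with the genuine `gpTP`, `CinvTP`.

## HONEST SCOPE

As `B6Prop23MultiLevelTorus`: print's carrier `T_η` with `Ω₁ = T_η` (levels `1 … k`), `A = 0`, `m² = 0`, `R ≥ 2L`,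
`L ≥ 2`, `P_μ ≥ 4`, constants depending on `d`, `L`; the ESTIMATE (2.87) and the existence / uniqueness of the inverse
are certified (by [3] Sect. 5 applied once on the whole of `𝔅`, on the GLOBAL lower bound (2.78) of file 2), the
EXPANSION (2.86) is not re-derived on `T_η` (it stays certified on the Neumann box, `B6Prop23MultiLevelBox`); the census
typing `B6.Prop23Printed` is (2.87).  The census hypothesis `Hyp21_22` of the member is `True` (the located (2.1)–(2.2)
are the fields of `D`) and is not used.  The census exponent `d` is instantiated at the lattice dimension `d + 1` of the
model.  Nothing is inferred from the manuscript: every step is kernel-checked.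
-/

namespace Literature.MathematicalPhysics.QuantumFieldTheory.Balaban1983to89.B6Prop23KLevelTorusCensus

open Finset Matrix
open Literature.MathematicalPhysics.QuantumFieldTheory.Balaban1983to89.B4Reflection242 (boxDom)
open Literature.MathematicalPhysics.QuantumFieldTheory.Balaban1983to89.B6MultiLevelBoxOperator
open Literature.MathematicalPhysics.QuantumFieldTheory.Balaban1983to89.B6MultiLevelTorusOperator (TDomains gmlT)
open Literature.MathematicalPhysics.QuantumFieldTheory.Balaban1983to89.B6Geom246MultiLevelBox
open Literature.MathematicalPhysics.QuantumFieldTheory.Balaban1983to89.B6Geom246MultiLevelTorus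
open Literature.MathematicalPhysics.QuantumFieldTheory.Balaban1983to89.B6Ineq268MultiLevelBox (W W_pos)
open Literature.MathematicalPhysics.QuantumFieldTheory.Balaban1983to89.B8Ineq192MultiLevelTorus (XkT geomT_len)
open Literature.MathematicalPhysics.QuantumFieldTheory.Balaban1983to89.B6Prop23MultiLevelTorus (BmT isUnit_BmT GinvT
  GinvT_mul_X X_mul_GinvT GinvT_unique prop23_multiLevelTorus)
open Literature.MathematicalPhysics.QuantumFieldTheory.Balaban1983to89.B6Expansion282 (kerOp)
open Literature.MathematicalPhysics.QuantumFieldTheory.Balaban1983to89.B6Prop23Chain (mat)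
open Literature.MathematicalPhysics.QuantumFieldTheory.Balaban1983to89.B6Prop22KLevelCensus (KIdx.aPrinted_windows)
open Literature.MathematicalPhysics.QuantumFieldTheory.Balaban1983to89.B6Prop22KLevelTorusCensus (KTIdx)
open Literature.MathematicalPhysics.QuantumFieldTheory.Balaban1983to89.B6Prop22KLevelTorusCensusEta (nKT nKT_pos geoTP gpTP
  geoTP_len kLevelTorusP_nonvacuous kLevelTorusP_top prop22Printed_kLevelTorusP)
open Literature.MathematicalPhysics.QuantumFieldTheory.Balaban1983to89.B6Ineq288Edge (ineq288_of_printed)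
open Literature.MathematicalPhysics.QuantumFieldTheory.Balaban1983to89.B6RandomWalk (Triangle254 Ineq260)
open Literature.MathematicalPhysics.QuantumFieldTheory.Balaban1983to89.B6Lemma21Repaired (Ineq261With)
open Literature.MathematicalPhysics.QuantumFieldTheory.Balaban1983to89.B6Cor28 (Ineq288)
open Literature.MathematicalPhysics.QuantumFieldTheory.Balaban1983to89.B6 (Geometry SiteKernel Prop23Printed pref4)

noncomputable section

variable {d : ℕ}

/-! ## §1 The inverse of `Q′G′²Q′*` of a torus member and its kernel in print's units -/

/-- the printed weights are positive: `0 < a_j` for `j ≥ 1` (`L ≥ 2`). [cite: Balaban1984PropagatorsII, (2.14) p.225, Prop. 2.2 p.234 («(a = 1)»)] -/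
theorem aPrinted_pos {ℓ : ℕ} (hℓ : 1 ≤ ℓ) : ∀ j, 1 ≤ j → 0 < aPrinted ℓ 1 j :=
  fun _ hj => (aPrinted_window hℓ one_pos hj).2.2

/-- the printed weights are at most `a = 1`. [cite: Balaban1984PropagatorsII, (2.14) p.225, Prop. 2.2 p.234 («(a = 1)»)] -/
theorem aPrinted_le_one {ℓ : ℕ} (hℓ : 1 ≤ ℓ) : ∀ j, 1 ≤ j → aPrinted ℓ 1 j ≤ 1 :=
  fun _ hj => (aPrinted_window hℓ one_pos hj).2.1

section Member

variable {ℓ : ℕ} (i : KTIdx d ℓ)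

/-- **`Q′G′²Q′*` OF THE TORUS MEMBER** as an operator on `ℝ^𝔅` in the pairing (2.69) (lattice units), `G′ = gmlT` genuine
with the printed weights. [cite: Balaban1984PropagatorsII, (2.69) p.235] -/
def XopT : Module.End ℝ (↥(bset i.D.toDomains) → ℝ) := kerOp (W i.D.toDomains) (XkT i.D (aPrinted ℓ 1))

/-- the conjugated kernel `B = Λ⁻²W^{½}·Q′G′²Q′*·W^{½}Λ⁻²` of the member is invertible — NO threshold on `M` («Of course
the operator Q′G′²Q′* is positive definite, so its inverse is well defined»). [cite: Balaban1984PropagatorsII, p.235 (before (2.70))] -/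
theorem isUnit_BmT_member (hℓ : 1 ≤ ℓ) : IsUnit (BmT i.D (aPrinted ℓ 1)) :=
  isUnit_BmT i.D (aPrinted ℓ 1) hℓ i.hMh i.hP (aPrinted_pos hℓ) (aPrinted_le_one hℓ)

/-- `(Q′G′²Q′*)⁻¹·(Q′G′²Q′*) = 1` for the member. [cite: Balaban1984PropagatorsII, Prop. 2.3 (2.86) p.238] -/
theorem GinvT_mul_XopT (hℓ : 1 ≤ ℓ) : GinvT i.D (aPrinted ℓ 1) * XopT i = 1 :=
  GinvT_mul_X i.D (aPrinted ℓ 1) (isUnit_BmT_member i hℓ)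

/-- `(Q′G′²Q′*)·(Q′G′²Q′*)⁻¹ = 1` for the member. [cite: Balaban1984PropagatorsII, Prop. 2.3 (2.86) p.238] -/
theorem XopT_mul_GinvT (hℓ : 1 ≤ ℓ) : XopT i * GinvT i.D (aPrinted ℓ 1) = 1 :=
  X_mul_GinvT i.D (aPrinted ℓ 1) (isUnit_BmT_member i hℓ)

/-- uniqueness: every left inverse of `Q′G′²Q′*` of the member is `GinvT`. [cite: Balaban1984PropagatorsII, p.235 («its inverse is well defined»)] -/
theorem GinvT_unique_member (hℓ : 1 ≤ ℓ) (G' : Module.End ℝ (↥(bset i.D.toDomains) → ℝ)) (hG' : G' * XopT i = 1) :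
    G' = GinvT i.D (aPrinted ℓ 1) :=
  GinvT_unique i.D (aPrinted ℓ 1) (isUnit_BmT_member i hℓ) G' hG'

/-- `Q′G′²Q′*` of the member is invertible. [cite: Balaban1984PropagatorsII, p.235 («so its inverse is well defined»)] -/
theorem XopT_isUnit (hℓ : 1 ≤ ℓ) : IsUnit (XopT i) :=
  ⟨⟨XopT i, GinvT i.D (aPrinted ℓ 1), XopT_mul_GinvT i hℓ, GinvT_mul_XopT i hℓ⟩, rfl⟩

/-- **THE CARRIER KERNEL OF `(Q′G′²Q′*)⁻¹` IN PRINT'S UNITS**: `Cinv(y, y′) = η^{−4−(d+1)}·GinvT(y, y′)/(L^{j′})^{d+1}`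
(`G′ ↦ η²G′` makes `Q′G′²Q′* ↦ η⁴·`, the (2.69) weight `(L^{j′}η)^{d+1} = η^{d+1}(L^{j′})^{d+1}`).
[cite: Balaban1984PropagatorsII, (2.69) p.235, (2.87) p.238, dictionary] -/
def CinvTP : SiteKernel (geoTP i) :=
  ⟨fun y y' => (((nKT i : ℕ) : ℝ)) ^ (4 + (d + 1)) * (mat (GinvT i.D (aPrinted ℓ 1)) y y' / W i.D.toDomains y')⟩

/-- the kernel, unfolded. [cite: Balaban1984PropagatorsII, (2.87) p.238, dictionary] -/
theorem CinvTP_ker (y y' : ↥(bset i.D.toDomains)) :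
    (CinvTP i).ker y y' = (((nKT i : ℕ) : ℝ)) ^ (4 + (d + 1)) * (mat (GinvT i.D (aPrinted ℓ 1)) y y' / W i.D.toDomains y') :=
  rfl

end Member

/-! ## §2 Proposition 2.3 in the census typing on the genuine `k`-level torus family -/

/-- print-unit powers: `(L^j·η)^{−m} = η^{−m}·(L^j)^{−m}` with `η^{−m} = (η⁻¹)^m`, `η⁻¹ = L^k`. [cite: Balaban1984PropagatorsII, (2.87) p.238, dictionary] -/
private theorem rpow_len_eta {t n : ℝ} (ht : 0 < t) (hn : 0 < n) (m : ℕ) :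
    (t * n⁻¹) ^ (-(m : ℝ)) = n ^ m * t ^ (-(m : ℝ)) := by
  rw [Real.mul_rpow ht.le (inv_nonneg.2 hn.le), Real.inv_rpow hn.le, Real.rpow_neg hn.le, inv_inv,
    Real.rpow_natCast, mul_comm]

/-- **[B6] PROPOSITION 2.3 (2.87) IN THE CENSUS TYPING, ON THE GENUINE `k`-LEVEL TORUS FAMILY IN PRINT'S UNITS**:
`B6.Prop23Printed (d + 1) geoTP CinvTP` — «∃ M₁ δ₁ C > 0 ∀ i, (2.1)–(2.2) → M₁ ≤ M → ∀ y y′,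
|(Q′G′²Q′*)⁻¹(y, y′)| ≤ C(L^jη)^{−4}(L^{j′}η)^{−(d+1)}e^{−½δ₁d(y,y′)}» for EVERY nested family of domains of the torus
with `k` levels (`Ω₁ = T_η`), `G′ = Δ′_a⁻¹` genuine, `Cinv` = the (2.69)-kernel of the inverse, `d` = print's distance
(2.46) on the torus; witnesses from `B6Prop23MultiLevelTorus.prop23_multiLevelTorus`.
[cite: Balaban1984PropagatorsII, Prop. 2.3 (2.87) p.238, (2.1) p.224 (Ω_j = T_η admitted)] -/
theorem prop23Printed_kLevelTorusP (d ℓ : ℕ) (hℓ : 1 ≤ ℓ) :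
    Prop23Printed (d + 1) (fun i : KTIdx d ℓ => geoTP i) (fun i => CinvTP i) := by
  -- the printed weights `a_j = aPrinted 1 j ∈ [1 − L⁻², 1]`, `c_j = 1`
  have hL2 : (1 : ℝ) < ((ℓ : ℝ) + 1) ^ 2 := by
    have : (2 : ℝ) ≤ (ℓ : ℝ) + 1 := by
      have : (1 : ℝ) ≤ ℓ := by exact_mod_cast hℓ
      linarith
    nlinarith
  have hamin : (0 : ℝ) < 1 - ((((ℓ : ℝ) + 1)) ^ 2)⁻¹ := by
    rw [sub_pos]; exact inv_lt_one_of_one_lt₀ hL2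
  obtain ⟨hwin, hrec⟩ := KIdx.aPrinted_windows hℓ
  obtain ⟨δ₁, C, M₀, hδ₁, hC, hM₀, h⟩ :=
    prop23_multiLevelTorus d ℓ hℓ (1 - ((((ℓ : ℝ) + 1)) ^ 2)⁻¹) 1 1 1 hamin one_pos
  refine ⟨M₀, δ₁, C, hM₀, hδ₁, hC, fun i _ hM y y' => ?_⟩
  obtain ⟨-, -, -, hb⟩ := h i.k i.Mh i.R hM i.hR i.P i.hP i.hP4 i.D (aPrinted ℓ 1) (fun _ => 1) hwin
    (fun _ _ => ⟨le_rfl, le_rfl⟩) hrec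
  have hη := nKT_pos i
  have hLj : ∀ s : ↥(bset i.D.toDomains), (0 : ℝ) < ((ℓ : ℝ) + 1) ^ s.1.1 := fun s => by positivity
  have hby := hb y y'
  rw [geomT_len, geomT_len, mul_one, mul_one] at hby
  show |(((nKT i : ℕ) : ℝ)) ^ (4 + (d + 1)) * (mat (GinvT i.D (aPrinted ℓ 1)) y y' / W i.D.toDomains y')| ≤
    C * (((ℓ : ℝ) + 1) ^ y.1.1 * (((nKT i : ℕ) : ℝ))⁻¹) ^ (-(4 : ℝ)) *
      (((ℓ : ℝ) + 1) ^ y'.1.1 * (((nKT i : ℕ) : ℝ))⁻¹) ^ (-((d + 1 : ℕ) : ℝ)) *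
      Real.exp (-(δ₁ / 2 * (geomT i.D).dist y y'))
  have e4 := rpow_len_eta (hLj y) hη 4
  have ed := rpow_len_eta (hLj y') hη (d + 1)
  push_cast at e4
  rw [abs_mul, abs_of_pos (pow_pos hη _), e4, ed, pow_add]
  have hP : (0 : ℝ) ≤ (((nKT i : ℕ) : ℝ)) ^ 4 * (((nKT i : ℕ) : ℝ)) ^ (d + 1) := by positivity
  calc (((nKT i : ℕ) : ℝ)) ^ 4 * (((nKT i : ℕ) : ℝ)) ^ (d + 1) * |mat (GinvT i.D (aPrinted ℓ 1)) y y' / W i.D.toDomains y'|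
      ≤ (((nKT i : ℕ) : ℝ)) ^ 4 * (((nKT i : ℕ) : ℝ)) ^ (d + 1) * (C * (((ℓ : ℝ) + 1) ^ y.1.1) ^ (-(4 : ℝ)) *
          (((ℓ : ℝ) + 1) ^ y'.1.1) ^ (-((d + 1 : ℕ) : ℝ)) * Real.exp (-(δ₁ / 2 * (geomT i.D).dist y y'))) :=
        mul_le_mul_of_nonneg_left hby hP
    _ = _ := by ring

/-- **NON-VACUITY**: above every threshold there are members with `k ≥ 2` genuine levels (file T9's
`kLevelTorusP_nonvacuous`), so the inhabited census fact constrains actual carriers. [cite: Balaban1984PropagatorsII, (2.1)–(2.4) p.224, bookkeeping] -/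
theorem prop23Printed_kLevelTorusP_nonvacuous (d ℓ k : ℕ) (hk : 2 ≤ k) (M₁ : ℝ) :
    ∃ i : KTIdx d ℓ, i.k = k ∧ M₁ ≤ (geoTP i).M ∧ (geoTP i).Hyp21_22 :=
  let ⟨i, h1, h2, h3, _, _⟩ := kLevelTorusP_nonvacuous d ℓ k hk M₁
  ⟨i, h1, h2, h3⟩

/-- **PRINT'S ADMITTED MEMBER `Ω₁ = … = Ω_k = T_η` IS CONSTRAINED** beyond every threshold (file T9's `kLevelTorusP_top`).
[cite: Balaban1984PropagatorsII, (2.1) p.224 («we admit the case when some domains Ω_j are equal to T_η»)] -/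
theorem prop23Printed_kLevelTorusP_top (d ℓ k : ℕ) (hk : 1 ≤ k) (M₁ : ℝ) :
    ∃ i : KTIdx d ℓ, i.k = k ∧ M₁ ≤ (geoTP i).M ∧ (geoTP i).Hyp21_22 ∧ ∀ s : (geoTP i).Site, (geoTP i).scale s = k :=
  kLevelTorusP_top d ℓ k hk M₁

/-! ## §3 The census edge «Prop. 2.2 ∧ Prop. 2.3 ⟹ (2.88)» fired on the genuine `k`-level torus family -/

/-- **THE DAG EDGE (2.88) ON THE GENUINE `k`-LEVEL TORUS FAMILY** («We have from Lemma 2.1, Proposition 2.2 and (2.87) …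
(2.88)»): `B6Ineq288Edge.ineq288_of_printed` with BOTH typed antecedents discharged on the family `geoTP` — Prop. 2.2 by
file T9's `prop22Printed_kLevelTorusP`, Prop. 2.3 by `prop23Printed_kLevelTorusP`.  The remaining hypotheses (the located
reading of the outer kernels `K₁ = ∂_μG′Q′*`, `K₃ = Q′G′∂_ν*` through entries of (2.67), Lemma 2.1 at `(δ, α)` per member
and the three thresholds) are those of the edge, verbatim, and are NOT discharged here.
[cite: Balaban1984PropagatorsII, (2.88) p.238; Prop. 2.2 p.234; Prop. 2.3 p.238] -/
theorem ineq288_edge_kLevelTorusP (d ℓ : ℕ) (hℓ : 1 ≤ ℓ) :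
    ∃ M₂ δ₀ δ₁ C' C'' : ℝ, 0 < M₂ ∧ 0 < δ₀ ∧ 0 < δ₁ ∧ 0 < C' ∧ 0 < C'' ∧
      ∀ i : KTIdx d ℓ, (geoTP i).Hyp21_22 → M₂ ≤ (geoTP i).M → Triangle254 (geoTP i) →
        (∀ y y', 0 ≤ (geoTP i).dist y y') →
        (∀ a b : (geoTP i).Site, (geoTP i).dist a b = (geoTP i).dist b a) → 1 ≤ (geoTP i).L → 0 < (geoTP i).eta →
        ∀ (n₁ n₃ : Fin 4), (∀ t, pref4 t n₁ = t) → (∀ t, pref4 t n₃ = t) →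
        ∀ (K₁ K₃ : (geoTP i).Site → (geoTP i).Site → ℝ) (lam₁ lam₃ : (geoTP i).Site → (geoTP i).Loc) (cQ : ℝ),
          0 ≤ cQ →
          (∀ y₁, (geoTP i).suppIn (lam₁ y₁) y₁) → (∀ y₁, (geoTP i).supNorm (lam₁ y₁) ≤ cQ) →
          (∀ y₂, (geoTP i).suppIn (lam₃ y₂) y₂) → (∀ y₂, (geoTP i).supNorm (lam₃ y₂) ≤ cQ) →
          (∀ y y₁, |K₁ y y₁| ≤ (gpTP i).e n₁ (lam₁ y₁) y) →
          (∀ y₂ y', |K₃ y₂ y'| ≤ (gpTP i).e n₃ (lam₃ y₂) y') →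
        ∀ (δ α cL : ℝ), 0 ≤ δ → 0 < α → α < 1 →
          δ + 2 * (α * δ) ≤ δ₀ / 2 → δ + α * δ ≤ δ₁ / 2 →
          Ineq260 (geoTP i) δ α → Ineq261With cL (geoTP i) δ α →
          (geoTP i).L ^ (4 : ℝ) ≤ Real.exp (α * δ * (geoTP i).R * (geoTP i).M) →
          (geoTP i).L ^ ((d + 1 : ℕ) : ℝ) ≤ Real.exp (α * δ * (geoTP i).R * (geoTP i).M) →
          (geoTP i).L ^ (1 : ℝ) ≤ Real.exp (α * δ * (geoTP i).R * (geoTP i).M) →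
          Ineq288 (geoTP i) (d + 1) K₁ (CinvTP i).ker K₃
            (C' * cQ * C'' * (C' * cQ) * (geoTP i).L ^ (4 : ℝ) * (geoTP i).L ^ ((d + 1 : ℕ) : ℝ) *
              (geoTP i).L ^ (1 : ℝ) * cL ^ 3) ((1 - α) * δ) :=
  ineq288_of_printed (d + 1) (fun i : KTIdx d ℓ => geoTP i) (fun i => gpTP i) (fun i => CinvTP i)
    (prop22Printed_kLevelTorusP d ℓ hℓ) (prop23Printed_kLevelTorusP d ℓ hℓ)

end

end Literature.MathematicalPhysics.QuantumFieldTheory.Balaban1983to89.B6Prop23KLevelTorusCensus
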